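/-
Copyright (c) 2026 the pub-hodgecm-mathlib formalisation cell (harness21).  Prover seat hodgecm-mathlib-LH6-p01 (g8): P6b wave C, row Dβ
(Dβ-thm step (E)) (desk F0P6b-plan (g14)); boxes LA-ref2 (g7) ∕ F0P6-ref1 (g9), 2026-09-03.
-/
import Literature.AlgebraicGeometry.AbelianSchemes.AbelianSchemeKOfL
import HarnessLib

/-!
# `Λ(L)` pulled back along the kernel translation `(z, (x, y)) ↦ (x, i z · y)` is `Λ(L)` pulled back along the projection — EXISTENCE of the
# isomorphism, for a `Z`-valued point `i ∈ K(L)(Z)` of an abelian scheme ([MumfordAV1970] §13, proof of the Theorem p. 125, scheme-theoretic `K(L)`)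

Layer `Literature/AlgebraicGeometry/AbelianSchemes`, namespace `Literature.AlgebraicGeometry.AbelianSchemes.AbelianSchemeOver`.  THEOREMS ONLY (no
definition, no named fact, no instance, no notation, no `sorry`).  Cell `pub/hodgecm-mathlib` (D-0151), P6b wave C, row Dβ, step (E) of (Dβ-thm)
(desk F0P6b-plan (g14)); organ capital for §D `stub_L4B1uD_mumfordLambdaDescent` of `Cruxes/HLiu418/Lines/F0_P6b_MumfordDualFlat.lean`
(lane `--supports stmt-HodgeConjecture-24832`); count-neutral.  HC_CM is proved only modulo the printed citations (2 remaining named inputs hLiu418 =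
`stmt-HodgeConjecture-24832`, h413 = `stmt-HodgeConjecture-24833`) until rung 0 closes; nothing here is about HC.

THE PRINT.  [MumfordAV1970] §13, proof of the Theorem p. 125: «the action of `K(L)` on the second factor of `X × X` lifts to an action on `Λ(L)`».
The tree has this for a SECTION `σ ∈ K(L)(S)` (★ `MumfordBundleTranslationStabilizer.nonempty_pullback_whiskerLeft_translation_mumfordBundle_iso`:
`(1 × t_σ)^*Λ(L) ≅ Λ(L)`, pure class calculus in `Ȟ¹(–, 𝒪^×)`, NO theorem of the square).  THIS FILE is the SCHEME-THEORETIC version needed for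
the finite flat (non-étale) `K(L)` of positive characteristic: `Z` is any `S`-scheme with a `Z`-valued point `i : Z → A` lying in `K(L)`
(★ `A.MemKOfL L i`: `(1_A × i)^*Λ(L)` trivial), and the statement lives on `A ×_S (Z ×_S A)`:

* §1 `cechPic_pullback_mul_comp_eq` — THE TRANSLATION FORM OF MEMBERSHIP AT ALL POINTS: if `(1_A × i)^*[Λ(L)] = 1` then for every `S`-scheme `T`,
  every `w : T → A` and every `v : T → Z`, `[w · (i ∘ v)]^*c = w^*c · (i ∘ v)^*c` (`c = [L]`; ★ `pullback_whiskerLeft_mumfordClass_eq_one_iff` at `u := i`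
  pulled back along `(w, v) : T → A ×_S Z`);
* §2 **`cechPic_pullback_whiskerLeft_act_mumfordClass`** — `(1_A × a)^*[Λ(L)] = (1_A × p₂)^*[Λ(L)]` in `Ȟ¹(A ×_S (Z ×_S A), 𝒪^×)` for the translation
  `a := (i × 1) ≫ m : Z ×_S A → A` (`(z, y) ↦ i z · y`) and the projection `p₂ : Z ×_S A → A` (§1 applied to `w = x·y` and `w = y`, `A` commutative); hence
  **`nonempty_pullback_whiskerLeft_act_mumfordBundle_iso`** — `(1_A × a)^*Λ(L) ≅ (1_A × p₂)^*Λ(L)` as modules for `L` of rank one (★ `nonempty_iso_iff_detClass_eq`);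
* §3 **`nonempty_pullback_kernelTranslation_mumfordBundle_iso`** — the same read on `Z ×_S (A ×_S A)` through the shuffle `(z, (x, y)) ↦ (x, (z, y))`:
  `σ^*Λ(L) ≅ p₂^*Λ(L)` for `σ = (z, (x, y)) ↦ (x, i z · y)` — the action morphism of ★ `GroupSchemes/TorsorSquareOfKernel` (Dα), spelled verbatim
  (`lift (snd ≫ fst) (lift fst (snd ≫ snd) ≫ (i ▷ A) ≫ μ)`) so that this file does not depend on it.
This is input (E) («some isomorphism exists») of the NORMALISED `Z`-linearisation of `Λ(L)` (Dβ-thm; rigid normalisation ★ `RigidifiedIsoNormalize`).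

## References
* [MumfordAV1970] D. Mumford, *Abelian Varieties* (1970), §13 (p. 123: `K(L)`; Thm. p. 125 and its proof).
* [MumfordFogartyKirwan1994] D. Mumford, J. Fogarty, F. Kirwan, *GIT* 3rd ed. (1994), Ch. 6 §2 Def. 6.2 (p. 120); App. 7B (p. 240).
* [MilneAV2008] J. S. Milne, *Abelian Varieties* (v2.00, 2008), I §8 (p. 40).
* [Hartshorne1977] R. Hartshorne, *Algebraic Geometry* (1977), III Ex. 4.5.
-/

set_option autoImplicit false

noncomputable section

-- `Scheme.Modules` / `SheafOfModules` are not reducible; `(A.X ⊗ T).left = pullback A.X.hom T.hom` holds by `rfl` only (as ★ `AbelianSchemeKOfL`).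
set_option backward.isDefEq.respectTransparency false

universe u

open CategoryTheory CategoryTheory.Limits AlgebraicGeometry MonoidalCategory CartesianMonoidalCategory
open scoped MonObj

namespace Literature.AlgebraicGeometry.AbelianSchemes

open Literature.AlgebraicGeometry.Motives Literature.AlgebraicGeometry.AbelianVarieties
  Literature.AlgebraicGeometry.Modules Literature.AlgebraicGeometry.RelativeSpec

namespace AbelianSchemeOver

variable {S : Scheme.{u}} (A : AbelianSchemeOver S) {Z : Over S} (i : Z ⟶ A.X)

/-- `x · z · u⁻¹ · (v · z)⁻¹ = x · u⁻¹ · v⁻¹` in a commutative group (class bookkeeping). [folklore] -/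
private theorem cancel_twist' {G : Type*} [CommGroup G] (x z u v : G) : x * z * u⁻¹ * (v * z)⁻¹ = x * u⁻¹ * v⁻¹ := by
  rw [mul_inv_rev, ← mul_assoc, mul_right_comm (x * z) u⁻¹ z⁻¹, mul_inv_cancel_right]

/-! ## §1 The translation form of membership, at all points -/

/-- `(w, v) ≫ (1_A × i) ≫ m = w · (v ≫ i)` in the group of `T`-valued points of `A`. [cite: MumfordFogartyKirwan1994, Ch. 6 §1 (p. 115)] -/
theorem lift_comp_whiskerLeft_comp_mul {T : Over S} (w : T ⟶ A.X) (v : T ⟶ Z) :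
    lift w v ≫ ((A.X ◁ i) ≫ μ[A.X]) = w * (v ≫ i) := by
  rw [A.whiskerLeft_comp_mul_eq i, MonObj.comp_mul, lift_fst, ← Category.assoc, lift_snd]

/-- **THE TRANSLATION FORM OF `i ∈ K(L)(Z)` AT ALL POINTS**: if `(1_A × i)^*[Λ]c = 1` on `A ×_S Z` then for every `w : T → A`, `v : T → Z`
over `S`, `[w · (v ≫ i)]^*c = [w]^*c · [v ≫ i]^*c` — ★ `pullback_whiskerLeft_mumfordClass_eq_one_iff` («`t_i^*L_Z ≅ L_Z ⊗ p_Z^* i^*L`») pulled back along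
the point `(w, v) : T → A ×_S Z`. [cite: MumfordFogartyKirwan1994, App. 7B, Definition of H(L) (p. 240)] [cite: MumfordAV1970, §13 (p. 123)] -/
theorem cechPic_pullback_mul_comp_eq (c : CechPic A.left) (hi : CechPic.pullback (A.X ◁ i).left (A.mumfordClass c) = 1)
    {T : Over S} (w : T ⟶ A.X) (v : T ⟶ Z) :
    CechPic.pullback (w * (v ≫ i)).left c = CechPic.pullback w.left c * CechPic.pullback (v ≫ i).left c := by
  have h := congrArg (CechPic.pullback (lift w v).left) ((A.pullback_whiskerLeft_mumfordClass_eq_one_iff c i).1 hi)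
  rw [map_mul, ← pullback_comp_left, ← pullback_comp_left, ← pullback_comp_left, A.lift_comp_whiskerLeft_comp_mul i w v,
    lift_fst, ← Category.assoc, lift_snd] at h
  exact h

/-! ## §2 `(1_A × a)^*Λ(L) ≅ (1_A × p₂)^*Λ(L)` on `A ×_S (Z ×_S A)` for the kernel translation `a = (i × 1) ≫ m` -/

section Class

variable [IsCommMonObj A.X]

omit [IsCommMonObj A.X] in
/-- The translation `a := (i × 1) ≫ m : Z ×_S A → A` on points: `a = (p₁ ≫ i) · p₂`. [cite: MumfordFogartyKirwan1994, Ch. 6 §1 (p. 115)] -/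
theorem whiskerRight_comp_mul_eq : (i ▷ A.X) ≫ μ[A.X] = (fst Z A.X ≫ i) * snd Z A.X := by
  rw [MonObj.mul_eq_mul, MonObj.comp_mul, whiskerRight_fst, whiskerRight_snd]

/-- **`(1_A × a)^*[Λ(L)] = (1_A × p₂)^*[Λ(L)]` in `Ȟ¹(A ×_S (Z ×_S A), 𝒪^×)`** for `a = (i × 1) ≫ m` and `i ∈ K(L)(Z)` (class form `(1_A × i)^*[Λ]c = 1`):
with `x = p_A`, `y = p ≫ p₂`, `ζ = p ≫ p₁ ≫ i`, ★ `pullback_whiskerLeft_mumfordClass` gives `[x·(ζ·y)]^*c·(x^*c)⁻¹·((ζ·y)^*c)⁻¹` resp. `[x·y]^*c·(x^*c)⁻¹·(y^*c)⁻¹`,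
and §1 at `w = x·y` and `w = y` (`A` commutative) contributes the same factor `ζ^*c` to the first and third terms.  NO theorem of the cube.
[cite: MumfordAV1970, §13 (Thm. p. 125, proof)] [cite: MilneAV2008, I §8 (p. 40)] -/
theorem cechPic_pullback_whiskerLeft_act_mumfordClass (c : CechPic A.left) (hi : CechPic.pullback (A.X ◁ i).left (A.mumfordClass c) = 1) :
    CechPic.pullback (A.X ◁ ((i ▷ A.X) ≫ μ[A.X])).left (A.mumfordClass c) =
      CechPic.pullback (A.X ◁ snd Z A.X).left (A.mumfordClass c) := by
  -- names of the points of `A ×_S (Z ×_S A)`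
  have hζy : snd A.X (Z ⊗ A.X) ≫ ((i ▷ A.X) ≫ μ[A.X]) =
      (snd A.X (Z ⊗ A.X) ≫ snd Z A.X) * ((snd A.X (Z ⊗ A.X) ≫ fst Z A.X) ≫ i) := by
    rw [A.whiskerRight_comp_mul_eq i, MonObj.comp_mul, Category.assoc, mul_comm]
  have hx : (A.X ◁ ((i ▷ A.X) ≫ μ[A.X])) ≫ μ[A.X] =
      (fst A.X (Z ⊗ A.X) * (snd A.X (Z ⊗ A.X) ≫ snd Z A.X)) * ((snd A.X (Z ⊗ A.X) ≫ fst Z A.X) ≫ i) := by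
    rw [A.whiskerLeft_comp_mul_eq, hζy, mul_assoc]
  have hy : (A.X ◁ snd Z A.X) ≫ μ[A.X] = fst A.X (Z ⊗ A.X) * (snd A.X (Z ⊗ A.X) ≫ snd Z A.X) :=
    A.whiskerLeft_comp_mul_eq _
  rw [A.pullback_whiskerLeft_mumfordClass, A.pullback_whiskerLeft_mumfordClass, hx, hζy, hy,
    A.cechPic_pullback_mul_comp_eq i c hi, A.cechPic_pullback_mul_comp_eq i c hi]
  exact cancel_twist' _ _ _ _

/-- **`(1_A × a)^*Λ(L) ≅ (1_A × p₂)^*Λ(L)` as `𝒪`-modules on `A ×_S (Z ×_S A)`**, for `L` of rank one and a `Z`-valued point `i ∈ K(L)(Z)` (`a = (i × 1) ≫ m`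
the kernel translation `(z, y) ↦ i z · y`): [MumfordAV1970] §13 «the action of `K(L)` on the second factor lifts to `Λ(L)`», existence of the lift over the
universal point; rank-one modules are classified by their classes (★ `nonempty_iso_iff_detClass_eq`).  The NORMALISED choice (unit + cocycle) is rigid
normalisation along `{0} × X`, downstream. [cite: MumfordAV1970, §13 (Thm. p. 125, proof)] [cite: Hartshorne1977, III Ex. 4.5] -/
theorem nonempty_pullback_whiskerLeft_act_mumfordBundle_iso {L : A.left.Modules} (hL : HasRank L 1) (hZL : A.MemKOfL L i) :
    Nonempty ((Scheme.Modules.pullback (A.X ◁ ((i ▷ A.X) ≫ μ[A.X])).left).obj (A.mumfordBundle L) ≅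
      (Scheme.Modules.pullback (A.X ◁ snd Z A.X).left).obj (A.mumfordBundle L)) := by
  have hΛ := A.hasRank_mumfordBundle hL
  have hΛ₁ := HasRank.isFiniteLocallyFree' hΛ
  refine (nonempty_iso_iff_detClass_eq (hasRank_pullback _ hΛ) (hasRank_pullback _ hΛ) (hΛ₁.pullback _) (hΛ₁.pullback _)).2 ?_
  rw [detClass_pullback _ hΛ₁, detClass_pullback _ hΛ₁, A.detClass_mumfordBundle hL hΛ₁]
  exact A.cechPic_pullback_whiskerLeft_act_mumfordClass i _ ((A.memKOfL_iff_mumfordClass hL i).1 hZL)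

end Class

/-! ## §3 The same on `Z ×_S (A ×_S A)`: `σ^*Λ(L) ≅ p₂^*Λ(L)` for the kernel translation `σ` on the second factor -/

section Shuffle

/-- The shuffle `(z, (x, y)) ↦ (x, (z, y))` followed by `1_A × a` is the kernel translation on the second factor `σ : (z, (x, y)) ↦ (x, i z · y)` (the action
morphism of ★ `GroupSchemes/TorsorSquareOfKernel`, spelled verbatim). [cite: MumfordAV1970, §13 (p. 125)] -/
theorem shuffle_comp_whiskerLeft_act :
    lift (snd Z (A.X ⊗ A.X) ≫ fst A.X A.X) (lift (fst Z (A.X ⊗ A.X)) (snd Z (A.X ⊗ A.X) ≫ snd A.X A.X)) ≫ (A.X ◁ ((i ▷ A.X) ≫ μ[A.X])) =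
      lift (snd Z (A.X ⊗ A.X) ≫ fst A.X A.X) (lift (fst Z (A.X ⊗ A.X)) (snd Z (A.X ⊗ A.X) ≫ snd A.X A.X) ≫ (i ▷ A.X) ≫ μ[A.X]) := by
  rw [lift_whiskerLeft]

/-- The shuffle followed by `1_A × p₂` is the projection `p₂ : Z ×_S (A ×_S A) → A ×_S A`. [cite: MumfordAV1970, §13 (p. 125)] -/
theorem shuffle_comp_whiskerLeft_snd :
    lift (snd Z (A.X ⊗ A.X) ≫ fst A.X A.X) (lift (fst Z (A.X ⊗ A.X)) (snd Z (A.X ⊗ A.X) ≫ snd A.X A.X)) ≫ (A.X ◁ snd Z A.X) =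
      snd Z (A.X ⊗ A.X) := by
  rw [lift_whiskerLeft, lift_snd]
  exact lift_comp_fst_snd _

variable [IsCommMonObj A.X]

/-- **`σ^*Λ(L) ≅ p₂^*Λ(L)` on `Z ×_S (A ×_S A)`** for the kernel translation `σ : (z, (x, y)) ↦ (x, i z · y)` of a `Z`-valued point `i ∈ K(L)(Z)` and `L` of
rank one — §2 transported along the shuffle `(z, (x, y)) ↦ (x, (z, y))` (Mathlib `pullbackComp`, `pullbackCongr`).  Input (E) of the normalised `Z`-linearisation
of `Λ(L)`. [cite: MumfordAV1970, §13 (Thm. p. 125, proof)] [cite: Hartshorne1977, III Ex. 4.5] -/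
theorem nonempty_pullback_kernelTranslation_mumfordBundle_iso {L : A.left.Modules} (hL : HasRank L 1) (hZL : A.MemKOfL L i) :
    Nonempty ((Scheme.Modules.pullback
        (lift (snd Z (A.X ⊗ A.X) ≫ fst A.X A.X) (lift (fst Z (A.X ⊗ A.X)) (snd Z (A.X ⊗ A.X) ≫ snd A.X A.X) ≫ (i ▷ A.X) ≫ μ[A.X])).left).obj
        (A.mumfordBundle L) ≅
      (Scheme.Modules.pullback (snd Z (A.X ⊗ A.X)).left).obj (A.mumfordBundle L)) := by
  obtain ⟨ψ⟩ := A.nonempty_pullback_whiskerLeft_act_mumfordBundle_iso i hL hZL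
  have h₁ := congrArg Over.Hom.left (A.shuffle_comp_whiskerLeft_act i)
  have h₂ := congrArg Over.Hom.left (A.shuffle_comp_whiskerLeft_snd (Z := Z))
  rw [Over.comp_left] at h₁ h₂
  exact ⟨((Scheme.Modules.pullbackCongr h₁).app _).symm ≪≫ ((Scheme.Modules.pullbackComp _ _).app _).symm ≪≫
    (Scheme.Modules.pullback _).mapIso ψ ≪≫ (Scheme.Modules.pullbackComp _ _).app _ ≪≫ (Scheme.Modules.pullbackCongr h₂).app _⟩

end Shuffle

end AbelianSchemeOver

end Literature.AlgebraicGeometry.AbelianSchemes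

end
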